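import Mathlib.Analysis.Calculus.Deriv.MeanValue
import Mathlib.LinearAlgebra.Multilinear.Basic
import Literature.Probability.LatticeModels.UrsellMonotonicity
import Literature.Probability.LatticeModels.UrsellExplicitFormula
import HarnessLib

/-!
# Camia–Jiang–Newman 2023: from Theorem 1 to the monotonicity of the cumulants of `X = Σ λ_u σ_u`

Topic `Literature/Probability/LatticeModels`; sibling PROOF file of `UrsellMonotonicity.lean`, which
vendors F. Camia, J. Jiang, C. M. Newman, *Monotonicity of Ursell functions in the Ising model*,
Comm. Math. Phys. 401 (2023) [CamiaJiangNewman2023] as the named facts `CamiaJiangNewman2023_thm1`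
(Thm 1, `(-1)^{k-1} ∂u_{2k}/∂J ≥ 0`) and `CamiaJiangNewman2023_thm2` (Thm 2, the first Lee–Yang zero
is antitone in the couplings).  The paper proves Thm 2 FROM Thm 1 (§1.2, "since the proof of
Theorem 2 given Theorem 1 is fairly short, we include it here"); this file and
`UrsellFirstZeroProofs.lean` formalise that deduction.  Here, the algebraic half:

* `PairIsing.setCoupling_*`, `avg_setCoupling_diag`, `ursell_setCoupling_diag` — bookkeeping for
  perturbing one coupling entry (a diagonal entry only rescales the weights);
* `differentiable_avg_setCoupling`, `differentiable_ursell_setCoupling` — Gibbs averages and Ursell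
  functions are differentiable (finite sums of exponentials) in one coupling;
* `monotoneOn_ursell_setCoupling`, `ursell_mono_of_thm1` — **given Thm 1**, `(-1)^{k-1}u_{2k}(c; j)`
  is nondecreasing in every entry of `c ≥ 0`, hence `≤` its value at any `c' ≥ c` (Thm 1 integrated
  along the entries of `ι × ι` one at a time; CJN: "we will prove that `|u_{2k}|` is increasing in
  `J`");
* `exists_multilinearMap_ursell`, `sum_finpartition_avg_pow_weightedMagnetization` — the partition
  sum `Σ_P (-1)^{|P|-1}(|P|-1)! ∏_B ⟨∏_{i∈B} Y_i⟩_c` is MULTILINEAR in the observables `Y_i`, whence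
  CJN eq. (14): `u_n(X,…,X) = Σ_j λ_{j_1}⋯λ_{j_n} u_n(σ_{j_1},…,σ_{j_n})` (`MultilinearMap.map_sum`);
* `cumulantOf_avg_pow_weightedMagnetization` — with the explicit Möbius formula
  (`cumulantOf_eq_sum_finpartition` of `UrsellExplicitFormula.lean`): the cumulants
  `κ_n = cumulantOf (m ↦ ⟨X^m⟩_c) n` of `X = Σ_u λ_u σ_u` equal `Σ_j (∏ λ_{j_i}) u_n(c; j)`;
* `cumulant_weightedMagnetization_mono_of_thm1` — **given Thm 1**, for `0 ≤ c ≤ c'` and `λ ≥ 0`,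
  `(-1)^{k-1} κ_{2k}(c) ≤ (-1)^{k-1} κ_{2k}(c')`.

No definitions, no named facts; Thm 1 enters as the hypothesis `(h1 : CamiaJiangNewman2023_thm1)`.

## References

* [CamiaJiangNewman2023] F. Camia, J. Jiang, C. M. Newman, CMP 401 (2023) 2459–2482,
  arXiv:2207.12247: Thm 1, §1.2 eq. (14) and the proof of Thm 2 (p. 4 of the arXiv version).
-/

noncomputable section

open Finset Set

namespace Literature.Probability.LatticeModels

namespace PairIsing

variable {ι : Type*} [Fintype ι] [DecidableEq ι]

/-! ### Algebra of `setCoupling` -/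

omit [Fintype ι] in
/-- The replaced entry. [folklore] -/
@[simp] theorem setCoupling_apply_same (c : ι → ι → ℝ) (u₀ v₀ : ι) (t : ℝ) :
    setCoupling c u₀ v₀ t u₀ v₀ = t := by
  simp [setCoupling]

omit [Fintype ι] in
/-- The other entries are unchanged. [folklore] -/
theorem setCoupling_apply_of_ne (c : ι → ι → ℝ) {u₀ v₀ a b : ι} (t : ℝ) (h : ¬ (a = u₀ ∧ b = v₀)) :
    setCoupling c u₀ v₀ t a b = c a b := by
  simp [setCoupling, h]

omit [Fintype ι] in
/-- Replacing the same entry twice. [folklore] -/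
@[simp] theorem setCoupling_setCoupling (c : ι → ι → ℝ) (u₀ v₀ : ι) (s t : ℝ) :
    setCoupling (setCoupling c u₀ v₀ s) u₀ v₀ t = setCoupling c u₀ v₀ t := by
  funext a b
  unfold setCoupling
  split_ifs <;> rfl

omit [Fintype ι] in
/-- Replacing an entry of a nonnegative matrix by a nonnegative number keeps it nonnegative.
[folklore] -/
theorem setCoupling_nonneg {c : ι → ι → ℝ} (hc : ∀ a b, 0 ≤ c a b) (u₀ v₀ : ι) {t : ℝ}
    (ht : 0 ≤ t) (a b : ι) : 0 ≤ setCoupling c u₀ v₀ t a b := by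
  unfold setCoupling
  split_ifs
  exacts [ht, hc a b]

/-- Changing a DIAGONAL coupling does not change Gibbs averages (it multiplies every weight by the
same constant). [folklore] -/
theorem avg_setCoupling_diag (c : ι → ι → ℝ) (u₀ : ι) (t : ℝ) (f : SpinConfig ι → ℝ) :
    avg (setCoupling c u₀ u₀ t) f = avg c f := by
  rw [← avg_offDiag (setCoupling c u₀ u₀ t), ← avg_offDiag c]
  congr 1
  funext a b
  unfold offDiag setCoupling
  by_cases hab : a = b
  · simp [hab]
  · rw [if_neg hab, if_neg hab, if_neg]
    rintro ⟨rfl, rfl⟩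
    exact hab rfl

/-- Changing a diagonal coupling does not change Ursell functions. [folklore] -/
theorem ursell_setCoupling_diag (c : ι → ι → ℝ) (u₀ : ι) (t : ℝ) {n : ℕ} (j : Fin n → ι) :
    ursell (setCoupling c u₀ u₀ t) j = ursell c j := by
  unfold ursell
  simp_rw [avg_setCoupling_diag]

/-! ### Differentiability in one coupling -/

/-- The Boltzmann weight is a differentiable function of one coupling entry. [folklore] -/
theorem differentiable_weight_setCoupling (c : ι → ι → ℝ) (u₀ v₀ : ι) (ρ : SpinConfig ι) :
    Differentiable ℝ (fun t => weight (setCoupling c u₀ v₀ t) ρ) := by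
  have h : ∀ a b, Differentiable ℝ
      (fun t : ℝ => setCoupling c u₀ v₀ t a b * (spinAt a ρ * spinAt b ρ)) := by
    intro a b
    unfold setCoupling
    by_cases hp : a = u₀ ∧ b = v₀
    · simp only [if_pos hp]; fun_prop
    · simp only [if_neg hp]; fun_prop
  unfold weight
  exact Real.differentiable_exp.comp
    (Differentiable.fun_sum fun a _ => Differentiable.fun_sum fun b _ => h a b)

/-- Gibbs averages are differentiable functions of one coupling entry. [folklore] -/
theorem differentiable_avg_setCoupling (c : ι → ι → ℝ) (u₀ v₀ : ι) (f : SpinConfig ι → ℝ) :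
    Differentiable ℝ (fun t => avg (setCoupling c u₀ v₀ t) f) := by
  unfold avg
  refine Differentiable.div ?_ ?_ fun t => (sum_weight_pos _).ne'
  · exact Differentiable.fun_sum fun ρ _ =>
      (differentiable_weight_setCoupling c u₀ v₀ ρ).const_mul (f ρ)
  · exact Differentiable.fun_sum fun ρ _ => differentiable_weight_setCoupling c u₀ v₀ ρ

/-- Ursell functions are differentiable functions of one coupling entry. [folklore] -/
theorem differentiable_ursell_setCoupling (c : ι → ι → ℝ) (u₀ v₀ : ι) {n : ℕ} (j : Fin n → ι) :
    Differentiable ℝ (fun t => ursell (setCoupling c u₀ v₀ t) j) := by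
  unfold ursell
  refine Differentiable.fun_sum fun P _ => ?_
  refine (Differentiable.fun_finsetProd fun B _ => ?_).const_mul _
  exact differentiable_avg_setCoupling c u₀ v₀ _

end PairIsing

/-! ### Monotonicity of `(-1)^{k-1} u_{2k}` in the couplings, from CJN Theorem 1 -/

section Monotone

variable {ι : Type} [Fintype ι] [DecidableEq ι]

open PairIsing

/-- From CJN Theorem 1: `t ↦ (-1)^{k-1} u_{2k}(setCoupling c u₀ v₀ t; j)` is monotone on `t ≥ 0`
(for `c ≥ 0`, `u₀ ≠ v₀`). [cite: CamiaJiangNewman2023, Thm 1] -/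
theorem monotoneOn_ursell_setCoupling (h1 : CamiaJiangNewman2023_thm1) {c : ι → ι → ℝ}
    (hc : ∀ a b, 0 ≤ c a b) {k : ℕ} (hk : 1 ≤ k) (j : Fin (2 * k) → ι) {u₀ v₀ : ι}
    (huv : u₀ ≠ v₀) :
    MonotoneOn (fun t => (-1 : ℝ) ^ (k - 1) * PairIsing.ursell (setCoupling c u₀ v₀ t) j)
      (Ici 0) := by
  have hd := differentiable_ursell_setCoupling c u₀ v₀ j
  refine monotoneOn_of_deriv_nonneg (convex_Ici 0) ?_ ?_ fun x hx => ?_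
  · exact ((continuous_const.mul hd.continuous)).continuousOn
  · exact (hd.const_mul _).differentiableOn
  · rw [interior_Ici, Set.mem_Ioi] at hx
    rw [deriv_const_mul _ (hd x)]
    have key := h1 ι (setCoupling c u₀ v₀ x) (setCoupling_nonneg hc u₀ v₀ hx.le) k hk j u₀ v₀ huv
    simpa only [setCoupling_setCoupling, setCoupling_apply_same] using key

/-- From CJN Theorem 1: raising one off-diagonal coupling raises `(-1)^{k-1} u_{2k}`.
[cite: CamiaJiangNewman2023, Thm 1] -/
theorem ursell_le_ursell_setCoupling (h1 : CamiaJiangNewman2023_thm1) {c : ι → ι → ℝ}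
    (hc : ∀ a b, 0 ≤ c a b) {k : ℕ} (hk : 1 ≤ k) (j : Fin (2 * k) → ι) (u₀ v₀ : ι) {t : ℝ}
    (ht : c u₀ v₀ ≤ t) :
    (-1 : ℝ) ^ (k - 1) * PairIsing.ursell c j ≤
      (-1 : ℝ) ^ (k - 1) * PairIsing.ursell (setCoupling c u₀ v₀ t) j := by
  by_cases huv : u₀ = v₀
  · subst huv
    rw [ursell_setCoupling_diag]
  · have hmono := monotoneOn_ursell_setCoupling h1 hc hk j huv
    have h := hmono (show c u₀ v₀ ∈ Ici (0 : ℝ) from hc u₀ v₀)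
      (show t ∈ Ici (0 : ℝ) from (hc u₀ v₀).trans ht) ht
    simpa only [setCoupling_self] using h

/-- **`(-1)^{k-1} u_{2k}` is increasing in the couplings** (CJN: "We will prove that `|u_{2k}|` is
increasing in `J`", Theorem 1 integrated along the entries): for `0 ≤ c ≤ c'` entrywise,
`(-1)^{k-1} u_{2k}(c; j) ≤ (-1)^{k-1} u_{2k}(c'; j)`. [cite: CamiaJiangNewman2023, Thm 1] -/
theorem ursell_mono_of_thm1 (h1 : CamiaJiangNewman2023_thm1) {c c' : ι → ι → ℝ}
    (hc : ∀ a b, 0 ≤ c a b) (hcc' : ∀ a b, c a b ≤ c' a b) {k : ℕ} (hk : 1 ≤ k)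
    (j : Fin (2 * k) → ι) :
    (-1 : ℝ) ^ (k - 1) * PairIsing.ursell c j ≤ (-1 : ℝ) ^ (k - 1) * PairIsing.ursell c' j := by
  -- interpolate through the matrices `mix S = [c' on S, c off S]`, `S ⊆ ι × ι`
  suffices H : ∀ S : Finset (ι × ι), (-1 : ℝ) ^ (k - 1) * PairIsing.ursell c j ≤
      (-1 : ℝ) ^ (k - 1) *
        PairIsing.ursell (fun a b => if (a, b) ∈ S then c' a b else c a b) j by
    simpa using H Finset.univ
  intro S
  induction S using Finset.induction_on with
  | empty => simp
  | insert p S hp ih =>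
    refine ih.trans ?_
    set d : ι → ι → ℝ := fun a b => if (a, b) ∈ S then c' a b else c a b with hd
    have hd0 : ∀ a b, 0 ≤ d a b := fun a b => by
      simp only [hd]; split_ifs; exacts [(hc a b).trans (hcc' a b), hc a b]
    have hstep : (fun a b => if (a, b) ∈ insert p S then c' a b else c a b) =
        setCoupling d p.1 p.2 (c' p.1 p.2) := by
      funext a b
      simp only [hd, setCoupling, Finset.mem_insert]
      by_cases hab : a = p.1 ∧ b = p.2
      · obtain ⟨rfl, rfl⟩ := hab
        simp
      · have hne : (a, b) ≠ p := fun h => hab ⟨by rw [← h], by rw [← h]⟩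
        simp [hab, hne]
    rw [hstep]
    refine ursell_le_ursell_setCoupling h1 hd0 hk j p.1 p.2 ?_
    simp only [hd]
    split_ifs
    exacts [le_rfl, hcc' _ _]

end Monotone

/-! ### The partition sum as a multilinear map; `u_n(X) = Σ_j λ_{j_1}⋯λ_{j_n} u_n(σ_j)` -/

namespace PairIsing

variable {ι : Type*} [Fintype ι] [DecidableEq ι]

/-- One block factor `⟨∏_{i ∈ B} Y_i⟩_c` of the partition formula is additive in the variable `Y_{i₀}`
for `i₀ ∈ B`. [folklore] -/
theorem avg_prod_update_add (c : ι → ι → ℝ) {n : ℕ} [DecidableEq (Fin n)] (B : Finset (Fin n))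
    (Y : Fin n → SpinConfig ι → ℝ) {i₀ : Fin n} (hi₀ : i₀ ∈ B) (Z Z' : SpinConfig ι → ℝ) :
    avg c (fun σ => ∏ i ∈ B, Function.update Y i₀ (Z + Z') i σ) =
      avg c (fun σ => ∏ i ∈ B, Function.update Y i₀ Z i σ) +
        avg c (fun σ => ∏ i ∈ B, Function.update Y i₀ Z' i σ) := by
  have key : ∀ W : SpinConfig ι → ℝ, (fun σ => ∏ i ∈ B, Function.update Y i₀ W i σ) =
      fun σ => W σ * ∏ i ∈ B.erase i₀, Y i σ := by
    intro W
    funext σ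
    rw [← mul_prod_erase B _ hi₀, Function.update_self]
    congr 1
    refine prod_congr rfl fun i hi => ?_
    rw [Function.update_of_ne (ne_of_mem_erase hi)]
  rw [key, key, key, ← avg_add]
  congr 1
  funext σ
  simp only [Pi.add_apply]
  ring

/-- One block factor is homogeneous in the variable `Y_{i₀}` for `i₀ ∈ B`. [folklore] -/
theorem avg_prod_update_smul (c : ι → ι → ℝ) {n : ℕ} [DecidableEq (Fin n)] (B : Finset (Fin n))
    (Y : Fin n → SpinConfig ι → ℝ) {i₀ : Fin n} (hi₀ : i₀ ∈ B) (r : ℝ) (Z : SpinConfig ι → ℝ) :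
    avg c (fun σ => ∏ i ∈ B, Function.update Y i₀ (r • Z) i σ) =
      r * avg c (fun σ => ∏ i ∈ B, Function.update Y i₀ Z i σ) := by
  have key : ∀ W : SpinConfig ι → ℝ, (fun σ => ∏ i ∈ B, Function.update Y i₀ W i σ) =
      fun σ => W σ * ∏ i ∈ B.erase i₀, Y i σ := by
    intro W
    funext σ
    rw [← mul_prod_erase B _ hi₀, Function.update_self]
    congr 1
    refine prod_congr rfl fun i hi => ?_
    rw [Function.update_of_ne (ne_of_mem_erase hi)]
  rw [key, key, ← avg_const_mul]
  congr 1
  funext σ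
  simp only [Pi.smul_apply, smul_eq_mul]
  ring

omit [Fintype ι] [DecidableEq ι] in
/-- A block factor not containing `i₀` does not see the variable `Y_{i₀}`. [folklore] -/
theorem prod_update_of_not_mem {n : ℕ} [DecidableEq (Fin n)] (B : Finset (Fin n))
    (Y : Fin n → SpinConfig ι → ℝ) {i₀ : Fin n} (hi₀ : i₀ ∉ B) (W : SpinConfig ι → ℝ)
    (σ : SpinConfig ι) :
    ∏ i ∈ B, Function.update Y i₀ W i σ = ∏ i ∈ B, Y i σ := by
  refine prod_congr rfl fun i hi => ?_
  rw [Function.update_of_ne]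
  rintro rfl
  exact hi₀ hi

/-- The product over the blocks of a partition of the block factors, with the variable `Y_{i₀}`
replaced by `W`, splits off the block of `i₀`. [folklore] -/
theorem prod_parts_update_eq (c : ι → ι → ℝ) {n : ℕ} [DecidableEq (Fin n)]
    (P : Finpartition (univ : Finset (Fin n))) (Y : Fin n → SpinConfig ι → ℝ) (i₀ : Fin n)
    {B₀ : Finset (Fin n)} (hB₀ : B₀ ∈ P.parts) (hi₀ : i₀ ∈ B₀) (W : SpinConfig ι → ℝ) :
    ∏ B ∈ P.parts, avg c (fun σ => ∏ i ∈ B, Function.update Y i₀ W i σ) =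
      avg c (fun σ => ∏ i ∈ B₀, Function.update Y i₀ W i σ) *
        ∏ B ∈ P.parts.erase B₀, avg c (fun σ => ∏ i ∈ B, Y i σ) := by
  rw [← mul_prod_erase P.parts _ hB₀]
  congr 1
  refine prod_congr rfl fun B hB => ?_
  obtain ⟨hne, hB⟩ := mem_erase.1 hB
  have hi₀B : i₀ ∉ B := fun h => hne (P.eq_of_mem_parts hB hB₀ h hi₀)
  congr 1
  funext σ
  exact prod_update_of_not_mem B Y hi₀B W σ

/-- **The partition formula is multilinear in the spin variables.** For couplings `c` and `n`, the
map `(Y_0,…,Y_{n-1}) ↦ Σ_P (-1)^{|P|-1}(|P|-1)! ∏_{B∈P} ⟨∏_{i∈B} Y_i⟩_c` on `n`-tuples of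
observables is a multilinear map (each `Y_i` sits in exactly one block of each partition).
[cite: CamiaJiangNewman2023, §1.2 eq. (14)] -/
theorem exists_multilinearMap_ursell (c : ι → ι → ℝ) (n : ℕ) :
    ∃ F : MultilinearMap ℝ (fun _ : Fin n => SpinConfig ι → ℝ) ℝ,
      ∀ Y : Fin n → SpinConfig ι → ℝ, F Y = ∑ P : Finpartition (univ : Finset (Fin n)),
        (-1 : ℝ) ^ (P.parts.card - 1) * ((P.parts.card - 1).factorial : ℝ) *
          ∏ B ∈ P.parts, avg c (fun σ => ∏ i ∈ B, Y i σ) := by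
  refine ⟨MultilinearMap.mk (fun Y => ∑ P : Finpartition (univ : Finset (Fin n)),
        (-1 : ℝ) ^ (P.parts.card - 1) * ((P.parts.card - 1).factorial : ℝ) *
          ∏ B ∈ P.parts, avg c (fun σ => ∏ i ∈ B, Y i σ)) ?_ ?_, fun Y => rfl⟩
  · intro inst Y i₀ Z Z'
    have hinst : inst = instDecidableEqFin n := Subsingleton.elim _ _
    subst hinst
    rw [← sum_add_distrib]
    refine sum_congr rfl fun P _ => ?_
    obtain ⟨B₀, hB₀, hi₀⟩ := P.exists_mem (mem_univ i₀)
    rw [prod_parts_update_eq c P Y i₀ hB₀ hi₀, prod_parts_update_eq c P Y i₀ hB₀ hi₀,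
      prod_parts_update_eq c P Y i₀ hB₀ hi₀, avg_prod_update_add c B₀ Y hi₀]
    ring
  · intro inst Y i₀ r Z
    have hinst : inst = instDecidableEqFin n := Subsingleton.elim _ _
    subst hinst
    rw [smul_eq_mul, mul_sum]
    refine sum_congr rfl fun P _ => ?_
    obtain ⟨B₀, hB₀, hi₀⟩ := P.exists_mem (mem_univ i₀)
    rw [prod_parts_update_eq c P Y i₀ hB₀ hi₀, prod_parts_update_eq c P Y i₀ hB₀ hi₀,
      avg_prod_update_smul c B₀ Y hi₀]
    ring

/-- **Multilinear expansion of the partition sum at `Y_i = X = Σ_u λ_u σ_u`** (CJN eq. (14)):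
`Σ_P (-1)^{|P|-1}(|P|-1)! ∏_{B∈P} ⟨X^{|B|}⟩_c = Σ_{j : [n] → ι} (∏_i λ_{j_i}) u_n(c; j)`.
[cite: CamiaJiangNewman2023, §1.2 eq. (14)] -/
theorem sum_finpartition_avg_pow_weightedMagnetization (c : ι → ι → ℝ) (lam : ι → ℝ) (n : ℕ) :
    ∑ P : Finpartition (univ : Finset (Fin n)),
        (-1 : ℝ) ^ (P.parts.card - 1) * ((P.parts.card - 1).factorial : ℝ) *
          ∏ B ∈ P.parts, avg c (fun σ => weightedMagnetization lam σ ^ B.card) =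
      ∑ j : Fin n → ι, (∏ i, lam (j i)) * ursell c j := by
  obtain ⟨F, hF⟩ := exists_multilinearMap_ursell c n
  -- the left side is `F (X, …, X)` with `X = Σ_u λ_u σ_u = Σ_u (λ_u • σ_u)`
  have hX : (fun (_ : Fin n) (σ : SpinConfig ι) => weightedMagnetization lam σ) =
      fun i => ∑ u : ι, (fun (_ : Fin n) (u : ι) => lam u • fun σ : SpinConfig ι => spinAt u σ) i u := by
    funext i σ
    simp only [weightedMagnetization, Finset.sum_apply, Pi.smul_apply, smul_eq_mul]
  have hL : ∑ P : Finpartition (univ : Finset (Fin n)),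
        (-1 : ℝ) ^ (P.parts.card - 1) * ((P.parts.card - 1).factorial : ℝ) *
          ∏ B ∈ P.parts, avg c (fun σ => weightedMagnetization lam σ ^ B.card) =
      F (fun _ σ => weightedMagnetization lam σ) := by
    rw [hF]
    simp_rw [prod_const]
  rw [hL, hX, F.map_sum]
  refine sum_congr rfl fun j _ => ?_
  rw [F.map_smul_univ, hF, smul_eq_mul]
  rfl

/-- **The cumulants of `X = Σ_u λ_u σ_u` through the Ursell functions of the spins** (CJN eq. (14),
with "(1) ⟺ (2)", the explicit Möbius formula `cumulantOf_eq_sum_finpartition`): for `n ≥ 1`,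
`κ_n(X; c) = cumulantOf (m ↦ ⟨X^m⟩_c) n = Σ_{j : [n] → ι} (∏_i λ_{j_i}) u_n(c; j)`.
[cite: CamiaJiangNewman2023, §1.2 eq. (14)] -/
theorem cumulantOf_avg_pow_weightedMagnetization (c : ι → ι → ℝ) (lam : ι → ℝ) {n : ℕ}
    (hn : 0 < n) :
    cumulantOf (fun m => avg c (fun σ => weightedMagnetization lam σ ^ m)) n =
      ∑ j : Fin n → ι, (∏ i, lam (j i)) * ursell c j := by
  rw [cumulantOf_eq_sum_finpartition _ (by simp [avg_const]) hn,
    ← sum_finpartition_avg_pow_weightedMagnetization c lam n]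

end PairIsing

section CumulantMono

variable {ι : Type} [Fintype ι] [DecidableEq ι]

open PairIsing

/-- **Monotonicity of the even cumulants of `X = Σ λ_u σ_u`, given CJN Theorem 1**: for
`0 ≤ c ≤ c'` entrywise, `λ ≥ 0` and `k ≥ 1`,
`(-1)^{k-1} κ_{2k}(X; c) ≤ (-1)^{k-1} κ_{2k}(X; c')` (CJN, proof of Thm 2: (14) with Thm 1).
[cite: CamiaJiangNewman2023, Thm 1 and §1.2 eq. (14)] -/
theorem cumulant_weightedMagnetization_mono_of_thm1 (h1 : CamiaJiangNewman2023_thm1)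
    {c c' : ι → ι → ℝ} (hc : ∀ a b, 0 ≤ c a b) (hcc' : ∀ a b, c a b ≤ c' a b) {lam : ι → ℝ}
    (hlam : ∀ u, 0 ≤ lam u) {k : ℕ} (hk : 1 ≤ k) :
    (-1 : ℝ) ^ (k - 1) * cumulantOf (fun m => avg c (fun σ => weightedMagnetization lam σ ^ m)) (2 * k) ≤
      (-1 : ℝ) ^ (k - 1) *
        cumulantOf (fun m => avg c' (fun σ => weightedMagnetization lam σ ^ m)) (2 * k) := by
  rw [cumulantOf_avg_pow_weightedMagnetization c lam (by omega),
    cumulantOf_avg_pow_weightedMagnetization c' lam (by omega), mul_sum, mul_sum]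
  refine sum_le_sum fun j _ => ?_
  rw [mul_left_comm, mul_left_comm ((-1 : ℝ) ^ (k - 1))]
  exact mul_le_mul_of_nonneg_left (ursell_mono_of_thm1 h1 hc hcc' hk j)
    (prod_nonneg fun i _ => hlam (j i))

end CumulantMono

end Literature.Probability.LatticeModels
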